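import Summits.ResolutionOfSingularities.ResolutionOfSingularities.Theorems.HomologicalConductorNoZenoSplitGaloisSymmetry
import Summits.ResolutionOfSingularities.ResolutionOfSingularities.Theorems.HomologicalConductorNoZenoSplitData

/-!
# Galois splitting base, V: the tower over the one-root germ and the D2′-currency package

W4.4 (crux `NoZenoR`, stmt-ResolutionOfSingularities-19943), slot 5 `stub_L1wCoreF`, brick
**D2″ (Galois refinement of the splitting base)**, ring side, part 5 (parts 1–4:
`…SplitGaloisRoots`, `…SplitGaloisClosure`, `…SplitGaloisGerm`, `…SplitGaloisSymmetry`).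

* `exists_algebra_tower_localization_integralClosure` — binder (B4) of res-L0-w44-stub-2's line:
  for any `D`-algebra `A ≃ₐ[D] D[X]/(f)`, local, formally unramified, essentially of finite type
  with `𝔪_D A = 𝔪_A` (the D2′ germ), `Ŝ = (integralClosure D L)_𝔫` is an `A`-algebra over `D`
  (root ↦ a root of `f`), FLAT (Mathlib `FormallyUnramified.flat_of_restrictScalars`), LOCAL,
  UNRAMIFIED (`𝔪_A Ŝ = 𝔪_Ŝ`), with separable residue extension — minimality descends along it;
* `exists_galoisGerm` — binder (B5): ONE ∃-theorem over the D2′ inputs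
  (`D : Subalgebra k K` local Noetherian normal with `Frac D = K`, `f` monic with irreducible
  separable reduction) delivering `Ŝ`, the one-root-germ tower to
  `locPrime (splitModel D f) (splitPrime D f)` (`…NoZenoSplitData`), and the finite group `H`
  with `ρ : H →* (Ŝ ≃ₐ[D] Ŝ)` inducing every `κ(D)`-automorphism of `κ(Ŝ)`, with `κ(Ŝ)/κ(D)`
  finite Galois and `dim Ŝ = dim D` (binders (B0)–(B3)).

* `exists_algEquiv_map_eq_of_isPrime` — binder (T): for `E/κ` finite Galois and any field
  `F ⊇ κ`, `Gal(E/κ)` (acting on the right factor) is TRANSITIVE on the primes of `F ⊗_κ E`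
  (fixed points come from `F` by flat base change of `0 → κ → E → E^{Gal}`,
  `mem_range_of_forall_map_eq`; then Mathlib's `Algebra.IsInvariant.exists_smul_of_under_eq`);
  combine with the residual surjectivity of `ρ` for the fibres `Spec(κ(η) ⊗_κ κ(Ŝ))`.

Everything is PROVED; no definitions, no named facts. [folklore; the packaging is this work]

OURS (cell res-hironaka, chain W4.4); AI-written, weaker than expert review; nothing here is a
statement of the manuscript under review; no Theses file is imported.
-/

noncomputable section

set_option linter.dupNamespace false

open Polynomial TensorProduct

namespace Summit.ResolutionOfSingularities.ResolutionOfSingularities.Theorems.NoZeno.SplittingBase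

universe u v

/-! ## D2″ over the one-root germ: the tower `D → D[X]/(f) → Ŝ` -/

section Tower

open IsLocalRing

variable {D K L : Type u} [CommRing D] [IsDomain D] [IsIntegrallyClosed D] [IsLocalRing D]
  [Field K] [Algebra D K] [IsFractionRing D K] [Field L] [Algebra K L] [Algebra D L]
  [IsScalarTower D K L]

omit [IsDomain D] [IsIntegrallyClosed D] [IsLocalRing D] [IsFractionRing D K] [IsScalarTower D K L] in
/-- The scalar tower `D → integralClosure D L → (integralClosure D L)_𝔫` (instance, recorded as a
theorem so that users with a concrete `D` need not search for it). [folklore] -/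
theorem isScalarTower_localization_integralClosure (𝔫 : Ideal (integralClosure D L))
    [𝔫.IsPrime] : IsScalarTower D (integralClosure D L) (Localization.AtPrime 𝔫) :=
  inferInstance

omit [IsDomain D] [IsIntegrallyClosed D] [IsFractionRing D K] [IsScalarTower D K L] in
/-- A monic polynomial with irreducible reduction has a root in any field where it splits.
[folklore] -/
theorem exists_mem_rootSet_of_irreducible_map {f : D[X]} (hf : f.Monic)
    (hirr : Irreducible (f.map (IsLocalRing.residue D)))
    (hsplit : (f.map (algebraMap D L)).Splits) : ∃ x : L, x ∈ f.rootSet L := by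
  have hdeg : (f.map (algebraMap D L)).degree ≠ 0 := by
    intro h0
    have hnat : f.natDegree = 0 := by
      rw [← hf.natDegree_map (algebraMap D L)]
      exact Polynomial.natDegree_eq_zero_iff_degree_le_zero.mpr h0.le
    have h1 : f.map (IsLocalRing.residue D) = 1 := by
      apply Polynomial.eq_one_of_monic_natDegree_zero (hf.map _)
      rw [hf.natDegree_map]
      exact hnat
    exact hirr.not_isUnit (h1 ▸ isUnit_one)
  obtain ⟨x, hx⟩ := hsplit.exists_eval_eq_zero hdeg
  refine ⟨x, ?_⟩
  rw [mem_rootSet']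
  exact ⟨(hf.map _).ne_zero, by rwa [aeval_def, ← eval_map]⟩

/-- **`Ŝ` over the one-root germ.** Any `D`-algebra `A ≃ₐ[D] D[X]/(f)` that is local, formally
unramified and essentially of finite type over `D` with `𝔪_D A = 𝔪_A` (the D2′ germ `S_f`) maps to
`Ŝ = (integralClosure D L)_𝔫` (root ↦ a chosen root of `f`), making `Ŝ` a FLAT, LOCAL, UNRAMIFIED
`A`-algebra over `D` with separable residue extension (minimality descends along `A → Ŝ`).
[folklore] -/
theorem exists_algebra_tower_localization_integralClosure {f : D[X]} (hf : f.Monic)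
    (hirr : Irreducible (f.map (IsLocalRing.residue D)))
    (hsep : (f.map (IsLocalRing.residue D)).Separable)
    [Polynomial.IsSplittingField K L (f.map (algebraMap D K))]
    (𝔫 : Ideal (integralClosure D L)) [𝔫.IsMaximal]
    {A : Type u} [CommRing A] [IsLocalRing A] [Algebra D A] [Algebra.FormallyUnramified D A]
    [Algebra.EssFiniteType D A] (e : AdjoinRoot f ≃ₐ[D] A)
    (hmA : (maximalIdeal D).map (algebraMap D A) = maximalIdeal A) :
    ∃ (_ : Algebra A (Localization.AtPrime 𝔫)) (_ : IsScalarTower D A (Localization.AtPrime 𝔫))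
      (_ : IsLocalHom (algebraMap A (Localization.AtPrime 𝔫)))
      (_ : Module.Flat A (Localization.AtPrime 𝔫)),
      (maximalIdeal A).map (algebraMap A (Localization.AtPrime 𝔫)) =
          maximalIdeal (Localization.AtPrime 𝔫) ∧
        Algebra.IsSeparable (ResidueField A) (ResidueField (Localization.AtPrime 𝔫)) := by
  classical
  -- a root of `f` in the integral closure, and the map `D[X]/(f) → Ŝ`
  obtain ⟨x, hxroot⟩ := exists_mem_rootSet_of_irreducible_map (L := L) hf hirr
    (splits_map_of_isSplittingField (K := K) (L := L) f)
  let a : integralClosure D L := ⟨x, rootSet_subset_integralClosure hf hxroot⟩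
  have ha1 : aeval a f = 0 := by
    apply Subtype.val_injective
    rw [← Subalgebra.aeval_coe, Subalgebra.coe_zero]
    exact (mem_rootSet'.mp hxroot).2
  have ha : f.eval₂ (algebraMap D (Localization.AtPrime 𝔫))
      (algebraMap (integralClosure D L) (Localization.AtPrime 𝔫) a) = 0 := by
    have h := Polynomial.hom_eval₂ f (algebraMap D (integralClosure D L))
      (algebraMap (integralClosure D L) (Localization.AtPrime 𝔫)) a
    rw [← IsScalarTower.algebraMap_eq D (integralClosure D L) (Localization.AtPrime 𝔫)] at h
    rw [← h, ← aeval_def, ha1, map_zero]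
  let φ : AdjoinRoot f →+* Localization.AtPrime 𝔫 :=
    AdjoinRoot.lift (algebraMap D (Localization.AtPrime 𝔫))
      (algebraMap (integralClosure D L) (Localization.AtPrime 𝔫) a) ha
  have hφ : ∀ d : D, φ (AdjoinRoot.of f d) = algebraMap D (Localization.AtPrime 𝔫) d :=
    fun d => RingHom.congr_fun (AdjoinRoot.lift_comp_of ha) d
  let ψ : A →+* Localization.AtPrime 𝔫 := φ.comp e.symm.toRingEquiv.toRingHom
  letI : Algebra A (Localization.AtPrime 𝔫) := ψ.toAlgebra
  have htower : IsScalarTower D A (Localization.AtPrime 𝔫) := by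
    refine IsScalarTower.of_algebraMap_eq fun d => ?_
    rw [RingHom.algebraMap_toAlgebra, RingHom.comp_apply]
    have h1 : e.symm.toRingEquiv.toRingHom (algebraMap D A d) = AdjoinRoot.of f d := by
      change e.symm (algebraMap D A d) = _
      rw [AlgEquiv.commutes, AdjoinRoot.algebraMap_eq]
    rw [h1, hφ]
  -- the bundle over `A`
  haveI := flat_localization_integralClosure (K := K) hf hsep 𝔫
  have hflatf : Module.Flat A (Localization.AtPrime 𝔫) :=
    Algebra.FormallyUnramified.flat_of_restrictScalars (R := D) (S := A) (Localization.AtPrime 𝔫)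
  have hm := map_maximalIdeal_localization_integralClosure (K := K) hf hsep 𝔫
  have hmf : (maximalIdeal A).map (algebraMap A (Localization.AtPrime 𝔫)) =
      maximalIdeal (Localization.AtPrime 𝔫) := by
    rw [← hmA, Ideal.map_map, ← IsScalarTower.algebraMap_eq]
    exact hm
  haveI hlocf : IsLocalHom (algebraMap A (Localization.AtPrime 𝔫)) :=
    ((IsLocalRing.local_hom_TFAE (algebraMap A (Localization.AtPrime 𝔫))).out 0 2).mpr hmf.le
  haveI := formallyUnramified_localization_integralClosure (K := K) hf hsep 𝔫
  haveI := essFiniteType_localization_integralClosure (K := K) hf hsep 𝔫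
  haveI : Algebra.FormallyUnramified A (Localization.AtPrime 𝔫) :=
    Algebra.FormallyUnramified.of_restrictScalars D _ _
  haveI : Algebra.EssFiniteType A (Localization.AtPrime 𝔫) := Algebra.EssFiniteType.of_comp D _ _
  have hsepf : Algebra.IsSeparable (ResidueField A) (ResidueField (Localization.AtPrime 𝔫)) :=
    inferInstance
  exact ⟨inferInstance, htower, hlocf, hflatf, hmf, hsepf⟩

end Tower

/-! ## D2″ in the currency of D2′ (`Sig.L1Core`): the Galois splitting germ over the one-root germ -/

section D2Currency

open IsLocalRing
open Summit.ResolutionOfSingularities.ResolutionOfSingularities.Theorems.NoZeno.SandwichCluster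
open Parasite (locPrime isLocalRing_locPrime)

variable {k K : Type} [Field k] [Field K] [Algebra k K]

/-- **D2″ — the Galois splitting germ, packaged over the D2′ inputs** (binders (B0)–(B5) of
res-L0-w44-stub-2's BINDER LINE 2026-08-27T18:13:56Z, with (B2)/(B3) in the `ρ : H →* (Ŝ ≃ₐ[D] Ŝ)`
form). For a local, Noetherian, normal `k`-subalgebra `D ⊆ K` with `Frac D = K` and a monic
`f ∈ D[X]` with irreducible separable reduction (`K_f := K[X]/(f_K)` a field), there are: a local
Noetherian normal domain `Ŝ`, flat, local and unramified (`𝔪_D Ŝ = 𝔪_Ŝ`) over `D`, with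
`κ(Ŝ)/κ(D)` finite GALOIS and `dim Ŝ = dim D`; an `S_f`-algebra structure over `D` on `Ŝ` for the
D2′ germ `S_f = locPrime (splitModel D f) (splitPrime D f)`, again flat, local and unramified with
separable residue extension; and a FINITE group `H` acting on `Ŝ` by `D`-algebra automorphisms
(`ρ`) such that every `κ(D)`-automorphism of `κ(Ŝ)` is induced by some `ρ h`.
(`Ŝ = (D[α₁,…,αₙ])_𝔫` inside a splitting field of `f` over `K`, `H` the stabiliser of `𝔫` in
`Gal`; parts 1–4.) [folklore; this work for the packaging] -/
theorem exists_galoisGerm (D : Subalgebra k K) [IsLocalRing ↥D] [IsNoetherianRing ↥D]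
    [IsIntegrallyClosed ↥D] [IsFractionRing ↥D K] (f : (↥D)[X])
    [Fact (Irreducible (f.map (algebraMap ↥D K)))] (hf : f.Monic)
    (hirr : Irreducible (f.map (residue ↥D))) (hsep : (f.map (residue ↥D)).Separable)
    (hPf : (splitPrime D f).IsPrime) :
    ∃ (Ŝ : Type) (_ : CommRing Ŝ) (_ : IsLocalRing Ŝ) (_ : IsNoetherianRing Ŝ) (_ : IsDomain Ŝ)
      (_ : IsIntegrallyClosed Ŝ) (_ : Algebra ↥D Ŝ)
      (_ : Algebra ↥(locPrime (splitModel D f) (splitPrime D f) hPf) Ŝ)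
      (_ : IsScalarTower ↥D ↥(locPrime (splitModel D f) (splitPrime D f) hPf) Ŝ)
      (_ : IsLocalHom (algebraMap ↥D Ŝ))
      (_ : IsLocalHom (algebraMap ↥(locPrime (splitModel D f) (splitPrime D f) hPf) Ŝ))
      (_ : Module.Flat ↥D Ŝ)
      (_ : Module.Flat ↥(locPrime (splitModel D f) (splitPrime D f) hPf) Ŝ)
      (H : Type) (_ : Group H) (_ : Finite H) (ρ : H →* (Ŝ ≃ₐ[↥D] Ŝ)),
      (maximalIdeal ↥D).map (algebraMap ↥D Ŝ) = maximalIdeal Ŝ ∧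
      (maximalIdeal ↥(locPrime (splitModel D f) (splitPrime D f) hPf)).map
          (algebraMap ↥(locPrime (splitModel D f) (splitPrime D f) hPf) Ŝ) = maximalIdeal Ŝ ∧
      FiniteDimensional (ResidueField ↥D) (ResidueField Ŝ) ∧
      IsGalois (ResidueField ↥D) (ResidueField Ŝ) ∧
      Algebra.IsSeparable (ResidueField ↥(locPrime (splitModel D f) (splitPrime D f) hPf))
        (ResidueField Ŝ) ∧
      ringKrullDim Ŝ = ringKrullDim ↥D ∧
      (∀ σ : ResidueField Ŝ ≃ₐ[ResidueField ↥D] ResidueField Ŝ, ∃ h : H, ∀ x : Ŝ,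
        residue Ŝ (ρ h x) = σ (residue Ŝ x)) := by
  classical
  -- the splitting field and the integral closure
  let L : Type := (f.map (algebraMap ↥D K)).SplittingField
  haveI : Polynomial.IsSplittingField K L (f.map (algebraMap ↥D K)) :=
    Polynomial.IsSplittingField.splittingField _
  haveI : FiniteDimensional K L :=
    Polynomial.IsSplittingField.finiteDimensional L (f.map (algebraMap ↥D K))
  obtain ⟨𝔫, h𝔫⟩ := exists_isMaximal_integralClosure (D := ↥D) (L := L)
  -- the germ and its bundle over `D`
  haveI hloc := isLocalHom_algebraMap_localization_integralClosure (D := ↥D) (L := L) 𝔫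
  have hflat := flat_localization_integralClosure (K := K) hf hsep 𝔫
  have hm := map_maximalIdeal_localization_integralClosure (K := K) hf hsep 𝔫
  have hfin := finite_residueField_localization_integralClosure (K := K) hf hsep 𝔫
  have hsepR := isSeparable_residueField_localization_integralClosure (K := K) hf hsep 𝔫
  have hnorm := normal_residueField_localization_integralClosure (K := K) hf hsep 𝔫
  have hnoeth := isNoetherianRing_localization_integralClosure (K := K) hf hsep 𝔫
  have hdim := ringKrullDim_localization_integralClosure (K := K) hf hsep 𝔫
  have hic := isIntegrallyClosed_localization_integralClosure (D := ↥D) (K := K) (L := L) 𝔫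
  have hdom : IsDomain (Localization.AtPrime 𝔫) :=
    IsLocalization.isDomain_localization
      (le_nonZeroDivisors_of_noZeroDivisors fun h => h (Ideal.zero_mem 𝔫))
  -- the symmetry
  obtain ⟨H, hH, hHf, ρ, hρ⟩ := exists_group_hom_residue_surjective (K := K) (L := L) hf hsep 𝔫
  -- the tower over the one-root germ `S_f`
  haveI := etale_germ D f hf hirr hsep hPf
  haveI := finite_germ D f hf hirr hPf
  obtain ⟨instA, htower, hlocf, hflatf, hmf, hsepf⟩ :=
    exists_algebra_tower_localization_integralClosure (K := K) (L := L) hf hirr hsep 𝔫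
      (splitGermAlgEquiv D f hf hirr hPf) (map_maximalIdeal_germ D f hf hirr hPf)
  exact ⟨Localization.AtPrime 𝔫, inferInstance, inferInstance, hnoeth, hdom, hic, inferInstance,
    instA, htower, hloc, hlocf, hflat, hflatf, H, hH, hHf, ρ, hm, hmf,
    hfin, isGalois_iff.mpr ⟨hsepR, hnorm⟩, hsepf, hdim, hρ⟩

end D2Currency

/-! ## Transitivity of a Galois group on the fibre `F ⊗_κ E` (binder (T) of res-L0-w44-stub-2) -/

section Transitive

variable {κ E : Type u} [Field κ] [Field E] [Algebra κ E] [FiniteDimensional κ E] [IsGalois κ E]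
  {F : Type v} [Field F] [Algebra κ F]

/-- The difference map `δ : E → E^{Gal}`, `e ↦ (g e − e)_g`; its kernel is `κ` (Galois
correspondence). [folklore] -/
theorem exact_algebraMap_galoisDiff :
    Function.Exact (Algebra.linearMap κ E)
      (LinearMap.pi fun g : E ≃ₐ[κ] E => (g.toLinearMap - LinearMap.id : E →ₗ[κ] E)) := by
  intro e
  constructor
  · intro he
    have hfix : ∀ g : E ≃ₐ[κ] E, g e = e := by
      intro g
      have := congr_fun he g
      simpa [sub_eq_zero] using this
    obtain ⟨c, hc⟩ := (IsGalois.mem_range_algebraMap_iff_fixed e).mpr hfix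
    exact ⟨c, hc⟩
  · rintro ⟨c, rfl⟩
    funext g
    simp

omit [FiniteDimensional κ E] [IsGalois κ E] in
/-- `1 ⊗ g` as a linear map is the base change of `g`. Bookkeeping. [folklore] -/
theorem lTensor_toLinearMap_eq_map (g : E ≃ₐ[κ] E) (z : F ⊗[κ] E) :
    (g.toLinearMap.lTensor F) z = Algebra.TensorProduct.map (AlgHom.id F F) (g : E →ₐ[κ] E) z := by
  induction z using TensorProduct.induction_on with
  | zero => simp
  | tmul a b => simp
  | add y z hy hz => rw [map_add, map_add, hy, hz]

/-- **Fixed points of `F ⊗_κ E` under `Gal(E/κ)` (acting on the right factor) come from `F`**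
(flat base change of the exact sequence `0 → κ → E → E^{Gal}` along `κ → F`). [folklore] -/
theorem mem_range_of_forall_map_eq (x : F ⊗[κ] E)
    (hx : ∀ g : E ≃ₐ[κ] E, Algebra.TensorProduct.map (AlgHom.id F F) (g : E →ₐ[κ] E) x = x) :
    x ∈ Set.range (algebraMap F (F ⊗[κ] E)) := by
  classical
  set δ : E →ₗ[κ] ((E ≃ₐ[κ] E) → E) :=
    LinearMap.pi fun g : E ≃ₐ[κ] E => (g.toLinearMap - LinearMap.id : E →ₗ[κ] E) with hδ
  have hexact := Module.Flat.lTensor_exact F (exact_algebraMap_galoisDiff (κ := κ) (E := E))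
  -- `(1 ⊗ δ) x = 0`, tested after `F ⊗ (Π E) ≃ Π (F ⊗ E)`
  have hzero : δ.lTensor F x = 0 := by
    apply (TensorProduct.piRight κ κ F (fun _ : E ≃ₐ[κ] E => E)).injective
    rw [map_zero]
    funext g
    have hcomp : (LinearMap.proj g ∘ₗ δ) = (g.toLinearMap - LinearMap.id : E →ₗ[κ] E) := by
      ext e; simp [hδ]
    have hpi : ∀ w : F ⊗[κ] ((E ≃ₐ[κ] E) → E),
        (TensorProduct.piRight κ κ F (fun _ : E ≃ₐ[κ] E => E)) w g =
          ((LinearMap.proj g : ((E ≃ₐ[κ] E) → E) →ₗ[κ] E).lTensor F) w := by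
      intro w
      induction w using TensorProduct.induction_on with
      | zero => simp
      | tmul a b => simp
      | add y z hy hz => simp only [map_add, Pi.add_apply, hy, hz]
    have h1 : (TensorProduct.piRight κ κ F (fun _ : E ≃ₐ[κ] E => E)) (δ.lTensor F x) g =
        ((LinearMap.proj g ∘ₗ δ).lTensor F) x := by
      rw [LinearMap.lTensor_comp, LinearMap.comp_apply, hpi]
    rw [h1, hcomp, LinearMap.lTensor_sub, LinearMap.lTensor_id, LinearMap.sub_apply,
      LinearMap.id_apply, Pi.zero_apply, sub_eq_zero]
    rw [lTensor_toLinearMap_eq_map, hx g]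
  obtain ⟨y, hy⟩ := (hexact x).mp hzero
  -- the image of `F ⊗ κ → F ⊗ E` is `F ⊗ 1`
  have hrange : ∀ y : F ⊗[κ] κ, (Algebra.linearMap κ E).lTensor F y ∈
      Set.range (algebraMap F (F ⊗[κ] E)) := by
    intro y
    induction y using TensorProduct.induction_on with
    | zero => exact ⟨0, by simp⟩
    | tmul a c =>
      refine ⟨c • a, ?_⟩
      rw [LinearMap.lTensor_tmul, Algebra.linearMap_apply, Algebra.TensorProduct.algebraMap_apply,
        Algebra.algebraMap_self, RingHom.id_apply, TensorProduct.smul_tmul,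
        Algebra.algebraMap_eq_smul_one]
    | add y z hy hz =>
      obtain ⟨a, ha⟩ := hy
      obtain ⟨b, hb⟩ := hz
      exact ⟨a + b, by rw [map_add, map_add, ha, hb]⟩
  rw [← hy]
  exact hrange y

/-- **`Gal(E/κ)` is transitive on the primes of `F ⊗_κ E`** for `E/κ` finite Galois and any
field `F ⊇ κ` (acting on the right factor): any two primes are conjugate. Via Mathlib's
`Algebra.IsInvariant.exists_smul_of_under_eq`. [folklore; Bourbaki, *Alg.* V §10] -/
theorem exists_algEquiv_map_eq_of_isPrime (P Q : Ideal (F ⊗[κ] E)) [P.IsPrime] [Q.IsPrime] :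
    ∃ τ : E ≃ₐ[κ] E,
      Q = P.map (Algebra.TensorProduct.map (AlgHom.id F F) (τ : E →ₐ[κ] E)) := by
  classical
  -- the action of `Gal(E/κ)` on `F ⊗ E` by `F`-algebra automorphisms
  let ρT : (E ≃ₐ[κ] E) →* ((F ⊗[κ] E) ≃ₐ[F] (F ⊗[κ] E)) :=
    { toFun := fun g => Algebra.TensorProduct.congr (AlgEquiv.refl : F ≃ₐ[F] F) g
      map_one' := by
        change Algebra.TensorProduct.congr AlgEquiv.refl (AlgEquiv.refl : E ≃ₐ[κ] E) = _
        rw [Algebra.TensorProduct.congr_refl]; rfl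
      map_mul' := fun g h => by
        change Algebra.TensorProduct.congr AlgEquiv.refl (h.trans g) = _
        rw [show (AlgEquiv.refl : F ≃ₐ[F] F) = AlgEquiv.refl.trans AlgEquiv.refl from rfl,
          Algebra.TensorProduct.congr_trans]
        rfl }
  letI : MulSemiringAction (E ≃ₐ[κ] E) (F ⊗[κ] E) := MulSemiringAction.compHom _ ρT
  have hsmul : ∀ (g : E ≃ₐ[κ] E) (x : F ⊗[κ] E),
      g • x = Algebra.TensorProduct.map (AlgHom.id F F) (g : E →ₐ[κ] E) x := fun g x => rfl
  haveI : SMulCommClass (E ≃ₐ[κ] E) F (F ⊗[κ] E) :=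
    ⟨fun g c x => by
      change ρT g (c • x) = c • ρT g x
      exact map_smul (ρT g) c x⟩
  haveI : Algebra.IsInvariant F (F ⊗[κ] E) (E ≃ₐ[κ] E) :=
    ⟨fun x hx => mem_range_of_forall_map_eq x fun g => by rw [← hsmul]; exact hx g⟩
  have hPQ : P.under F = Q.under F := by
    have hP : P.under F = ⊥ := by
      rcases Ideal.eq_bot_or_top (P.under F) with h | h
      · exact h
      · exact absurd h (Ideal.IsPrime.under F P).ne_top
    have hQ : Q.under F = ⊥ := by
      rcases Ideal.eq_bot_or_top (Q.under F) with h | h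
      · exact h
      · exact absurd h (Ideal.IsPrime.under F Q).ne_top
    rw [hP, hQ]
  obtain ⟨g, hg⟩ := Algebra.IsInvariant.exists_smul_of_under_eq F (F ⊗[κ] E) (E ≃ₐ[κ] E) P Q hPQ
  refine ⟨g, ?_⟩
  rw [hg]
  rfl

end Transitive

end Summit.ResolutionOfSingularities.ResolutionOfSingularities.Theorems.NoZeno.SplittingBase

end
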